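import Summits.CriticalPhenomena.SAWScalingLimit.Theorems.AvoidanceLimit.Negative.AvoidanceLimitWitnessDomains

/-!
# Negative knowledge on crux `AvoidanceLimit`, part 2: the chordal normalisation is load-bearing

Support file (refuter / cdisprove lane) for the crux
`Summit.CriticalPhenomena.SAWScalingLimit.Theses.SAWLoopFugacityFlow.AvoidanceLimit`
(stmt-CriticalPhenomena-10649, route SAWLoopFugacityFlow, rank 2): for every Dobrushin domain
`(D; a, b)`, hull subdomain `D'`, endpoint approximation, chordal uniformizer `φ`, pulled-back hull
`A = closure (ℍ ∖ φ⁻¹ D')` and restriction data `(Φ, d = Φ'_A(0))`,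
`P_δ(range γ_δ ⊆ closure D') → d^(5/8)` as `δ → 0+`. The crux itself is NOT refuted (it follows from
`SAWScalingLimit`; LSW04 Prediction 1 on avoidance marginals); the `Negative/` files record, as
kernel-checked theorems, which hypotheses any proof MUST use: each variant is the crux with ONE
hypothesis dropped or weakened, everything else verbatim, and each is FALSE.

**`avoidanceLimit_false_without_chordal`** — drop `D.IsChordalUniformizing φ`: take `D = bigSq`,
`D' = flatRect` and `φ` a chordal uniformizer of the RE-MARKED square `topSq`, so that `φ → 1+2i` at
`0` and `φ → -1+2i` at `∞`, both off `closure D'`. Then `ℍ ∖ A = φ⁻¹ D'` is bounded and bounded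
away from `0`, the two normalising filters `𝓝[ℍ ∖ A] 0` and `cocompact ⊓ 𝓟 (ℍ ∖ A)` are `⊥`, any
Riemann map `Φ : ℍ ∖ A → ℍ` (tree: `exists_conformalEquiv_upperHalfPlaneSet_holds`) is a
"restriction map" with EVERY derivative `d`, and the conclusion would hold for `d = 1` and `d = 0`
at once (`1 ≠ 0`). Moral for provers: the chordal normalisation is exactly what makes
`0 ∈ closure (ℍ ∖ A)` (pins `d`) and `ℍ ∖ A ⊇ ℍ ∖ (compact)` (pins the scale of `Φ_A`). [folklore]
-/

noncomputable section

open Set Filter Topology MeasureTheory Complex Metric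
open UpperHalfPlane (upperHalfPlaneSet isOpen_upperHalfPlaneSet)
open Literature.Probability.RandomPlanarGeometry Literature.Probability.LatticeModels
open Summit.CriticalPhenomena.SAWScalingLimit.Theses.SAWLoopFugacityFlow (AvoidanceLimit)

namespace Summit.CriticalPhenomena.SAWScalingLimit.Theorems.AvoidanceLimit.Negative

/-! ### (a) Load-bearing hypothesis: the chordal normalisation of `φ` -/

/-- The crux with the hypothesis `D.IsChordalUniformizing φ` DROPPED (everything else verbatim). -/
def AvoidanceLimitWithoutChordal : Prop :=
  ∀ (D D' : DobrushinDomain) (a b : ℝ → Site 2), SAW.IsEndpointApprox D a b →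
    D'.carrier ⊆ D.carrier → D'.pt 0 = D.pt 0 → D'.pt 1 = D.pt 1 →
    (∃ ε : ℝ, 0 < ε ∧ D'.carrier ∩ Metric.ball (D.pt 0) ε = D.carrier ∩ Metric.ball (D.pt 0) ε ∧
      D'.carrier ∩ Metric.ball (D.pt 1) ε = D.carrier ∩ Metric.ball (D.pt 1) ε) →
    ∀ (φ : ConformalEquiv upperHalfPlaneSet D.carrier),
    ∀ (A : Set ℂ), A = closure (upperHalfPlaneSet \ {z | z ∈ upperHalfPlaneSet ∧ φ z ∈ D'.carrier}) →
    ∀ (Φ : ConformalEquiv (upperHalfPlaneSet \ A) upperHalfPlaneSet) (d : ℝ),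
      IsRestrictionMap A Φ → HasRestrictionDeriv A Φ d →
      Tendsto (fun δ => ((SAW.law D.carrier δ (a δ) (b δ)).map (fun γ => γ.curve))
        (CurveClass.rangeSubset (closure D'.carrier))) (𝓝[>] 0)
        (𝓝 (ENNReal.ofReal (d ^ ((5 : ℝ) / 8))))


/-- **`IsChordalUniformizing` is load-bearing.** Witness: `D = bigSq`, `D' = flatRect`, `φ` a chordal
uniformizer of the RE-MARKED square `topSq` (so `φ → 1+2i` at `0`, `φ → -1+2i` at `∞`, both off
`closure D'`): then `ℍ ∖ A = φ⁻¹(D')` stays away from `0` and from `∞`, the two normalising filters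
`𝓝[ℍ ∖ A] 0` and `cocompact ⊓ 𝓟 (ℍ ∖ A)` are `⊥`, every Riemann map `Φ : ℍ ∖ A → ℍ` is a
"restriction map" with EVERY derivative `d`, and the conclusion would hold for `d = 1` and `d = 0`
at once. Moral for provers: the chordal normalisation is exactly what makes `0 ∈ closure (ℍ ∖ A)`
(pins `d`) and `ℍ ∖ A ⊇ ℍ ∖ (compact)` (pins the scale of `Φ`). [folklore] -/
theorem avoidanceLimit_false_without_chordal : ¬ AvoidanceLimitWithoutChordal := by
  intro h
  obtain ⟨a, b, hab⟩ := SAW.exists_isEndpointApprox bigSq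
  obtain ⟨φ, hφ⟩ := MarkedDomain.exists_isChordalUniformizing_holds topSq
  have hball : ∃ ε : ℝ, 0 < ε ∧
      flatRect.carrier ∩ Metric.ball (bigSq.pt 0) ε = bigSq.carrier ∩ Metric.ball (bigSq.pt 0) ε ∧
      flatRect.carrier ∩ Metric.ball (bigSq.pt 1) ε = bigSq.carrier ∩ Metric.ball (bigSq.pt 1) ε := by
    refine ⟨1, one_pos, ?_, ?_⟩
    · rw [bigSq_pt_zero]; exact flatRect_ball_agree 2 (by simp)
    · rw [bigSq_pt_one]; exact flatRect_ball_agree (-2) (by simp)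
  have hpt0 : flatRect.pt 0 = bigSq.pt 0 := by rw [flatRect_pt_zero, bigSq_pt_zero]
  have hpt1 : flatRect.pt 1 = bigSq.pt 1 := by rw [flatRect_pt_one, bigSq_pt_one]
  -- the pulled-back hull of the strip under the re-marked uniformizer
  set A : Set ℂ := φ.pullbackHull flatRect with hAdef
  have key := h bigSq flatRect a b hab flatRect_subset hpt0 hpt1 hball φ A rfl
  -- `ℍ ∖ A = φ⁻¹(D')`
  have hdiff : upperHalfPlaneSet \ A = φ.pullbackDomain flatRect := ConformalEquiv.diff_pullbackHull
  -- (1) the filter at `0` is trivial: `φ z → topSq.pt 0 ∉ closure D'`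
  have hbot0 : 𝓝[upperHalfPlaneSet \ A] (0 : ℂ) = ⊥ := by
    have hev : ∀ᶠ z in 𝓝[upperHalfPlaneSet] (0 : ℂ), φ z ∈ (closure flatRect.carrier)ᶜ :=
      hφ.1 (isClosed_closure.isOpen_compl.mem_nhds (topSq_pt_notMem_closure 0))
    have hle : 𝓝[upperHalfPlaneSet \ A] (0 : ℂ) ≤ 𝓝[upperHalfPlaneSet] 0 :=
      nhdsWithin_mono _ sdiff_le
    rw [← Filter.eventually_false_iff_eq_bot]
    filter_upwards [hle hev, self_mem_nhdsWithin] with z hz hzA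
    rw [hdiff] at hzA
    exact hz (subset_closure hzA.2)
  -- (2) the filter at `∞` is trivial: `φ z → topSq.pt 1 ∉ closure D'`
  have hbotInf : cocompact ℂ ⊓ 𝓟 (upperHalfPlaneSet \ A) = ⊥ := by
    have hev : ∀ᶠ z in cocompact ℂ ⊓ 𝓟 upperHalfPlaneSet, φ z ∈ (closure flatRect.carrier)ᶜ :=
      hφ.2 (isClosed_closure.isOpen_compl.mem_nhds (topSq_pt_notMem_closure 1))
    have hle : cocompact ℂ ⊓ 𝓟 (upperHalfPlaneSet \ A) ≤ cocompact ℂ ⊓ 𝓟 upperHalfPlaneSet :=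
      inf_le_inf_left _ (principal_mono.2 sdiff_le)
    rw [← Filter.eventually_false_iff_eq_bot]
    have hself : ∀ᶠ z in cocompact ℂ ⊓ 𝓟 (upperHalfPlaneSet \ A), z ∈ upperHalfPlaneSet \ A :=
      mem_inf_of_right (mem_principal_self _)
    filter_upwards [hle hev, hself] with z hz hzA
    rw [hdiff] at hzA
    exact hz (subset_closure hzA.2)
  -- a Riemann map of `ℍ ∖ A ≅ D'`
  have hsc : IsSimplyConnected (upperHalfPlaneSet \ A) :=
    (φ.restrHull flatRect flatRect_subset).isSimplyConnected_iff.2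
      (JordanDomain.isSimplyConnected_carrier flatRect.toJordanDomain)
  have hopen : IsOpen (upperHalfPlaneSet \ A) := by
    rw [hdiff]; exact ConformalEquiv.isOpen_pullbackDomain
  have hne : upperHalfPlaneSet \ A ≠ univ := fun heq ↦ by
    have : (-I : ℂ) ∈ upperHalfPlaneSet \ A := by rw [heq]; exact mem_univ _
    have h' : (0 : ℝ) < (-I).im := this.1
    norm_num at h'
  obtain ⟨Ψ⟩ := exists_conformalEquiv_upperHalfPlaneSet_holds hopen hsc hne
  set Φ := Ψ.symm with hΦ
  have hR : IsRestrictionMap A Φ := by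
    refine ⟨?_, ?_⟩
    · show Tendsto Φ (𝓝[upperHalfPlaneSet \ A] 0) (𝓝 0)
      rw [hbot0]; exact tendsto_bot
    · rw [hbotInf]; exact tendsto_bot
  have hD : ∀ d : ℝ, HasRestrictionDeriv A Φ d := fun d ↦ by
    show Tendsto _ (𝓝[upperHalfPlaneSet \ A] 0) _
    rw [hbot0]; exact tendsto_bot
  exact one_ne_zero_rpow (limit_unique (key Φ 1 hR (hD 1)) (key Φ 0 hR (hD 0)))


end Summit.CriticalPhenomena.SAWScalingLimit.Theorems.AvoidanceLimit.Negative

end
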